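import Summits.CriticalPhenomena.SAWScalingLimit.Theorems.SAWDefectDecoherenceBoundaryClosureRInnerZigzagGrid
import Summits.CriticalPhenomena.SAWScalingLimit.Theorems.SAWDefectDecoherenceBoundaryClosureRInnerZigzagCells
import Literature.Probability.RandomPlanarGeometry.ChordalCurveFamily
import Literature.Analysis.FluidPDE.HarnackChainCover
import HarnessLib

/-!
# Crux `BoundaryClosureR` (stmt-CriticalPhenomena-14004), line `polygon-parity-squeeze`,
# stub `stub_innerZigzagPolygon` (7a): set-up lemmas of the inner polygon — pins, trapezoids,
# tiles, windows, and the similarity back to the datum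

Landing target:
`Summits/CriticalPhenomena/SAWScalingLimit/Theorems/SAWDefectDecoherenceBoundaryClosureRInnerZigzagSetup.lean`
(`--supports stmt-CriticalPhenomena-14004`; building block C3 of the registered stub
`stub_innerZigzagPolygon`, the continuum half of the inner-polygon construction (IP)).

Pieces of the final assembly of the inner zigzag polygon which do not involve the boundary walk
(normalised coordinates `w`, real point `o + h·w`):

* `abs_triX_le`, `abs_triY_le` — lattice coordinates against `re`, `im`;
* `mem_trapezoid_of_low` — **a cell meeting the upper half-ball of radius `Rb` about a pin within
  height `9` is a face of the pin's trapezoid** (base `a ≥ Rb + 30`, `20` rows);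
* `not_mem_tileFaces_of_vertex`, `faceL_mem_tileFaces_of_deep_vertex` — no tile at a vertex off `Ω`,
  all six faces in tiles at a `9h`-deep vertex (the corner hypotheses of
  `trapezoid_union_tiles_noPinch`);
* `vertical_escape` — a point of an open `P` with `P ⊔ V = (frontier P)ᶜ` cannot see, straight below
  it off `frontier P`, a point of `V` (the window argument for `P ⊆ Ω`);
* the similarity `simHomeomorph o h : ℂ ≃ₜ ℂ`, `w ↦ o + h·w` (data), with its images of balls,
  half-planes and upper half-planes (`image_sim_ball`, `image_sim_halfPlane`, `image_sim_upper`);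
* `mem_K_of_upper_one`, `mem_K_of_upper_zero`, `mem_K_of_deep` — every cell meeting the upper
  half-ball of radius `(7/8)ρ/h` at the gate pin (resp. `(7/8)r₁/h` at the root pin), or a `9h`-deep
  point, is in the face set `tileFaces S ∪ R₁ ∪ R₀` of the construction;
* `exists_deep_core` (a connected compact of positive depth through the `η`-deep part and two points,
  `Literature.Analysis.FluidPDE.exists_isCompact_isConnected_superset`), `flat_normalised` (the flat
  pinned balls read in the normalised coordinate).

Sources: folklore.  No proposition is defined and no named fact is introduced.
-/

noncomputable section

open scoped ComplexConjugate
open Set Metric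
open Literature.Probability.LatticeModels
open Literature.Probability.Percolation (triX triY triCell triCellStrict triX_triEmbed triY_triEmbed triDir)
open Literature.Probability.RandomPlanarGeometry
open Summit.CriticalPhenomena.SAWScalingLimit.Theorems.PolygonParitySqueeze.BoundaryWalk

namespace Summit.CriticalPhenomena.SAWScalingLimit.Theorems.PolygonParitySqueeze.InnerZigzag

/-! ### 1. Lattice coordinates against `re`, `im` -/

/-- `|X(w)| ≤ |re w| + |im w|`. [folklore] -/
theorem abs_triX_le (w : ℂ) : |triX w| ≤ |w.re| + |w.im| := by
  have h3 : (1 : ℝ) ≤ Real.sqrt 3 := Literature.Probability.Percolation.one_le_sqrt_three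
  have hpos : (0 : ℝ) < Real.sqrt 3 := by positivity
  have h1 : |w.im / Real.sqrt 3| ≤ |w.im| := by
    rw [abs_div, abs_of_pos hpos]
    exact div_le_self (abs_nonneg _) h3
  calc |triX w| = |w.re - w.im / Real.sqrt 3| := rfl
    _ ≤ |w.re| + |w.im / Real.sqrt 3| := abs_sub _ _
    _ ≤ |w.re| + |w.im| := by linarith

/-- `|Y(w)| ≤ 2 |im w|`. [folklore] -/
theorem abs_triY_le (w : ℂ) : |triY w| ≤ 2 * |w.im| := by
  have h3 : (1 : ℝ) ≤ Real.sqrt 3 := Literature.Probability.Percolation.one_le_sqrt_three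
  have hpos : (0 : ℝ) < Real.sqrt 3 := by positivity
  show |w.im * 2 / Real.sqrt 3| ≤ 2 * |w.im|
  rw [abs_div, abs_mul, abs_of_pos hpos, abs_two, div_le_iff₀ hpos]
  nlinarith [abs_nonneg w.im]

/-- `Y` vanishes exactly on the real axis and has the sign of `im`. [folklore] -/
theorem triY_pos_iff (w : ℂ) : 0 < triY w ↔ 0 < w.im := by
  have hpos : (0 : ℝ) < Real.sqrt 3 := by positivity
  show 0 < w.im * 2 / Real.sqrt 3 ↔ 0 < w.im
  rw [div_pos_iff_of_pos_right hpos]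
  constructor <;> intro h <;> linarith

/-! ### 2. Cells meeting a low half-ball are trapezoid faces -/

/-- **A cell meeting the upper half-ball of radius `Rb` about the pin point `c` (on the base row
`Y₀`, within `1/2` of the base lattice point `X₀` along the row) at height `< 9` is a face of the
trapezoid with base `[X₀ - a, X₀ + a]`, `a ≥ Rb + 30`, and `20` rows.** [folklore] -/
theorem mem_trapezoid_of_low {R : Finset HexVertex} {a X₀ Y₀ : ℤ}
    (hR : ∀ F : HexVertex, F ∈ R ↔
      ∀ v ∈ hexFaceVertices F, Y₀ ≤ v 1 ∧ v 1 ≤ Y₀ + 20 ∧ X₀ - a ≤ v 0 ∧ (v 0 - X₀) + (v 1 - Y₀) ≤ a)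
    {c : ℂ} (hcY : triY c = Y₀) (hcX : |triX c - X₀| ≤ 1 / 2) {Rb : ℝ} (ha : Rb + 30 ≤ a)
    {F : HexVertex} {w : ℂ} (hw : w ∈ triCell F) (hwB : ‖w - c‖ < Rb) (him : 0 < (w - c).im) (him9 : (w - c).im < 9) :
    F ∈ R := by
  rw [hR]
  intro v hv
  obtain ⟨b1, b2, b3, b4, b5, b6⟩ := vertex_coords_near hw hv
  have hX := abs_triX_le (w - c)
  have hY := abs_triY_le (w - c)
  have hYpos := (triY_pos_iff (w - c)).2 him
  rw [Literature.Probability.Percolation.triX_sub] at hX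
  rw [Literature.Probability.Percolation.triY_sub] at hY hYpos
  have hre : |(w - c).re| ≤ ‖w - c‖ := Complex.abs_re_le_norm _
  rw [abs_of_pos him] at hX hY
  have hX' := abs_le.1 hX
  have hY' := abs_le.1 hY
  have hcX' := abs_le.1 hcX
  have hre' := abs_le.1 hre
  -- integer conclusions
  have i1 : Y₀ ≤ v 1 := by
    have : (Y₀ : ℝ) < v 1 + 1 := by linarith
    have : Y₀ < v 1 + 1 := by exact_mod_cast this
    omega
  have i2 : v 1 ≤ Y₀ + 20 := by
    have : (v 1 : ℝ) ≤ Y₀ + 20 := by linarith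
    exact_mod_cast this
  have i3 : X₀ - a ≤ v 0 := by
    have : (X₀ : ℝ) - a ≤ v 0 := by linarith
    exact_mod_cast this
  have i4 : (v 0 - X₀) + (v 1 - Y₀) ≤ a := by
    have : ((v 0 : ℝ) - X₀) + (v 1 - Y₀) ≤ a := by linarith
    exact_mod_cast this
  exact ⟨i1, i2, i3, i4⟩

/-! ### 3. Tiles at the corners of the trapezoids -/

/-- **No tile face at a vertex off `Ω`** (tile cells are `(η₁ - 4h)`-deep, `η₁ > 4h`). [folklore] -/
theorem not_mem_tileFaces_of_vertex {Ω : Set ℂ} (o : ℂ) {h η₁ : ℝ} (hh : 0 ≤ h) (hη : 4 * h < η₁)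
    {S : Finset (Site 2)} (hS : ∀ c ∈ S, η₁ ≤ infDist (o + h * triEmbed c) Ωᶜ) {v : Site 2}
    (hv : o + h * triEmbed v ∉ Ω) (k : Fin 6) : faceL v k ∉ tileFaces S := by
  intro hF
  have hvc : triEmbed v ∈ triCell (faceL v k) := triEmbed_mem_triCell (by rw [hexFaceVertices_faceL]; simp)
  have hdeep := tile_cell_deep o hh hS hF hvc
  exact hv (mem_of_infDist_pos (by linarith))

/-- **All six faces sit in tiles at a `(η₁ + 4h)`-deep vertex.** [folklore] -/
theorem faceL_mem_tileFaces_of_deep_vertex {Ω : Set ℂ} (o : ℂ) {h η₁ : ℝ} (hh : 0 ≤ h) {S : Finset (Site 2)}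
    (hS : ∀ c : Site 2, (c 0 - c 1) % 3 = 0 → η₁ ≤ infDist (o + h * triEmbed c) Ωᶜ → c ∈ S) {v : Site 2}
    (hv : η₁ + 4 * h ≤ infDist (o + h * triEmbed v) Ωᶜ) (k : Fin 6) : faceL v k ∈ tileFaces S :=
  mem_tileFaces_of_deep o hh hS (triEmbed_mem_triCell (by rw [hexFaceVertices_faceL]; simp)) hv

/-! ### 4. The vertical escape -/

/-- **Vertical escape.** Let `P`, `V` be disjoint open sets with `P ∪ V = (frontier P)ᶜ`, `w ∈ P`,
`σ ≤ im w`, such that no point `re w + i s`, `σ ≤ s < im w`, is on `frontier P`, while `re w + i σ ∈ V`.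
This is absurd (the vertical segment is connected, misses `frontier P`, meets `P` and `V`).
[folklore] -/
theorem vertical_escape {P V : Set ℂ} (hPo : IsOpen P) (hVo : IsOpen V) (hPV : Disjoint P V)
    (hunion : P ∪ V = (frontier P)ᶜ) {w : ℂ} (hw : w ∈ P) {σ : ℝ} (hσ : σ ≤ w.im)
    (hoff : ∀ s : ℝ, σ ≤ s → s < w.im → (⟨w.re, s⟩ : ℂ) ∉ frontier P) (hbot : (⟨w.re, σ⟩ : ℂ) ∈ V) : False := by
  set w' : ℂ := ⟨w.re, σ⟩ with hw'
  have hseg : segment ℝ w w' ⊆ P ∪ V := by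
    rw [hunion]
    intro u hu huΓ
    rw [segment_eq_image'] at hu
    obtain ⟨θ, ⟨hθ0, hθ1⟩, rfl⟩ := hu
    dsimp only at huΓ
    rcases hθ0.lt_or_eq with hθ | rfl
    · have hs : σ ≤ (w + θ • (w' - w)).im ∧ (w + θ • (w' - w)).im < w.im ∨ σ = w.im := by
        simp only [Complex.add_im, Complex.real_smul, Complex.mul_im, Complex.ofReal_re, Complex.ofReal_im,
          Complex.sub_im, zero_mul, add_zero, hw']
        rcases hσ.lt_or_eq with h | h
        · left; constructor <;> nlinarith
        · right; exact h
      rcases hs with ⟨h1, h2⟩ | h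
      · have e : w + θ • (w' - w) = ⟨w.re, (w + θ • (w' - w)).im⟩ := by
          apply Complex.ext <;> simp [hw']
        rw [e] at huΓ
        exact hoff _ h1 h2 huΓ
      · -- degenerate: `w' = w`
        have e : w' = w := by apply Complex.ext <;> simp [hw', h]
        rw [e, sub_self, smul_zero, add_zero] at huΓ
        have : w ∈ P ∩ frontier P := ⟨hw, huΓ⟩
        rw [hPo.inter_frontier_eq] at this
        exact this
    · simp only [zero_smul, add_zero] at huΓ
      have : w ∈ P ∩ frontier P := ⟨hw, huΓ⟩
      rw [hPo.inter_frontier_eq] at this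
      exact this
  rcases (convex_segment w w').isPreconnected.subset_or_subset hPo hVo hPV hseg with h | h
  · exact Set.disjoint_left.1 hPV (h (right_mem_segment ℝ w w')) hbot
  · exact Set.disjoint_left.1 hPV hw (h (left_mem_segment ℝ w w'))

/-! ### 5. The similarity back to the datum -/

/-- **The similarity `w ↦ o + h·w`** as a homeomorphism of the plane (data; `h ≠ 0`). [folklore] -/
def simHomeomorph (o : ℂ) (h : ℝ) (hh : h ≠ 0) : ℂ ≃ₜ ℂ :=
  (Homeomorph.mulLeft₀ (h : ℂ) (Complex.ofReal_ne_zero.2 hh)).trans (Homeomorph.addLeft o)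

/-- The similarity, pointwise. [folklore] -/
@[simp] theorem simHomeomorph_apply (o : ℂ) (h : ℝ) (hh : h ≠ 0) (w : ℂ) : simHomeomorph o h hh w = o + h * w := rfl

/-- The image of a set under the similarity is its preimage under the inverse similarity, i.e.
`z ∈ image ↔ (z - o)/h ∈ set`; here in the form used below: membership of `o + h·w`. [folklore] -/
theorem mem_image_sim_iff (o : ℂ) {h : ℝ} (hh : h ≠ 0) (A : Set ℂ) (w : ℂ) :
    o + h * w ∈ (fun w => o + h * w) '' A ↔ w ∈ A := by
  constructor
  · rintro ⟨w', hw', he⟩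
    have : w' = w := by
      have h1 : (h : ℂ) * w' = h * w := by simpa using he
      exact mul_left_cancel₀ (Complex.ofReal_ne_zero.2 hh) h1
    rw [← this]; exact hw'
  · exact fun hw => ⟨w, hw, rfl⟩

/-- Every point is the image of its normalised coordinate. [folklore] -/
theorem sim_surj (o : ℂ) {h : ℝ} (hh : h ≠ 0) (z : ℂ) : o + h * ((h : ℂ)⁻¹ * (z - o)) = z := by
  have : (h : ℂ) ≠ 0 := Complex.ofReal_ne_zero.2 hh
  field_simp
  ring

/-- **Images of balls.** [folklore] -/
theorem image_sim_ball (o : ℂ) {h : ℝ} (hh : 0 < h) (c : ℂ) (s : ℝ) :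
    (fun w => o + h * w) '' ball c s = ball (o + h * c) (h * s) := by
  ext z
  rw [← sim_surj o hh.ne' z, mem_image_sim_iff o hh.ne', sim_mem_ball_iff o hh, mul_div_cancel_left₀ _ hh.ne']

/-- **Images of zigzag half-planes.** [folklore] -/
theorem image_sim_halfPlane (o : ℂ) {h : ℝ} (hh : 0 < h) (k : Fin 6) (c : ℂ) :
    (fun w => o + h * w) '' halfPlane k c = halfPlane k (o + h * c) := by
  ext z
  rw [← sim_surj o hh.ne' z, mem_image_sim_iff o hh.ne', sim_mem_halfPlane_iff o hh]

/-- **Images of upper half-planes.** [folklore] -/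
theorem image_sim_upper (o : ℂ) {h : ℝ} (hh : 0 < h) (c : ℂ) :
    (fun w => o + h * w) '' {w : ℂ | c.im < w.im} = {z : ℂ | (o + h * c).im < z.im} := by
  ext z
  rw [← sim_surj o hh.ne' z, mem_image_sim_iff o hh.ne']
  simp only [mem_setOf_eq]
  rw [sim_im_lt_iff o hh]

/-- Images commute with binary intersections (the similarity is injective) and unions. [folklore] -/
theorem image_sim_inter_union (o : ℂ) {h : ℝ} (hh : h ≠ 0) (A B : Set ℂ) :
    (fun w => o + h * w) '' (A ∩ B) = (fun w => o + h * w) '' A ∩ (fun w => o + h * w) '' B ∧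
    (fun w => o + h * w) '' (A ∪ B) = (fun w => o + h * w) '' A ∪ (fun w => o + h * w) '' B := by
  refine ⟨Set.image_inter fun w w' he => ?_, Set.image_union _ _ _⟩
  have h1 : (h : ℂ) * w = h * w' := by simpa using he
  exact mul_left_cancel₀ (Complex.ofReal_ne_zero.2 hh) h1

/-! ### 6. Cells meeting the pinned half-balls or deep points are in `K` -/

section Pins

variable {Ω : Set ℂ} {o p0n : ℂ} {h ρ r₁ : ℝ} {N X₀ a a₀ : ℤ} {S : Finset (Site 2)} {R₁ R₀ : Finset HexVertex}
  (hh : 0 < h) (hρ : 4000 * h ≤ ρ) (hr₁ : 4000 * h ≤ r₁)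
  (hp0n : triY p0n = N ∧ |triX p0n - X₀| ≤ 1 / 2)
  (ha : (a : ℝ) ≤ 9 / 10 * (ρ / h) ∧ 9 / 10 * (ρ / h) - 1 < a)
  (ha₀ : (a₀ : ℝ) ≤ 9 / 10 * (r₁ / h) ∧ 9 / 10 * (r₁ / h) - 1 < a₀)
  (hS : ∀ c : Site 2, c ∈ S ↔ (c 0 - c 1) % 3 = 0 ∧ 5 * h ≤ infDist (o + h * triEmbed c) Ωᶜ)
  (hR₁ : ∀ F : HexVertex, F ∈ R₁ ↔
    ∀ v ∈ hexFaceVertices F, 0 ≤ v 1 ∧ v 1 ≤ 0 + 20 ∧ 0 - a ≤ v 0 ∧ (v 0 - 0) + (v 1 - 0) ≤ a)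
  (hR₀ : ∀ F : HexVertex, F ∈ R₀ ↔
    ∀ v ∈ hexFaceVertices F, N ≤ v 1 ∧ v 1 ≤ N + 20 ∧ X₀ - a₀ ≤ v 0 ∧ (v 0 - X₀) + (v 1 - N) ≤ a₀)
  (hdepth1 : ∀ w : ℂ, ‖w‖ < ρ / h → min (h * w.im) (ρ - h * ‖w‖) ≤ infDist (o + h * w) Ωᶜ)
  (hdepth0 : ∀ w : ℂ, ‖w - p0n‖ < r₁ / h → min (h * (w - p0n).im) (r₁ - h * ‖w - p0n‖) ≤ infDist (o + h * w) Ωᶜ)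

include hh hρ ha hS hR₁ hdepth1 in
/-- **Every cell meeting the upper half-ball of radius `(7/8)ρ/h` at the gate pin is in `K`**
(`9`-high points are `9h`-deep: tiles; lower ones are in the gate trapezoid). [folklore] -/
theorem mem_K_of_upper_one {F : HexVertex} {w : ℂ} (hw : w ∈ triCell F) (hwB : ‖w‖ < 7 / 8 * (ρ / h)) (him : 0 < w.im) :
    F ∈ tileFaces S ∪ R₁ ∪ R₀ := by
  have hρh : 4000 ≤ ρ / h := by rw [le_div_iff₀ hh]; linarith
  by_cases h9 : 9 ≤ w.im
  · -- deep: a tile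
    have hSc : ∀ c : Site 2, (c 0 - c 1) % 3 = 0 → 5 * h ≤ infDist (o + h * triEmbed c) Ωᶜ → c ∈ S :=
      fun c h1 h2 => (hS c).2 ⟨h1, h2⟩
    refine Finset.mem_union_left _ (Finset.mem_union_left _ (mem_tileFaces_of_deep o hh.le hSc hw ?_))
    have hd := hdepth1 w (by linarith)
    have h1 : 9 * h ≤ h * w.im := by nlinarith
    have h2 : 9 * h ≤ ρ - h * ‖w‖ := by
      have : h * ‖w‖ < h * (7 / 8 * (ρ / h)) := mul_lt_mul_of_pos_left hwB hh
      have e : h * (7 / 8 * (ρ / h)) = 7 / 8 * ρ := by field_simp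
      nlinarith
    have := le_min h1 h2
    linarith
  · refine Finset.mem_union_left _ (Finset.mem_union_right _ ?_)
    refine mem_trapezoid_of_low (X₀ := 0) (Y₀ := 0) hR₁ (c := 0) (by simp [Literature.Probability.Percolation.triY])
      (by simp [Literature.Probability.Percolation.triX]) (Rb := 7 / 8 * (ρ / h)) (by linarith [ha.2]) hw
      (by simpa using hwB) (by simpa using him) (by simp; linarith)

include hh hr₁ hp0n ha₀ hS hR₀ hdepth0 in
/-- **Every cell meeting the upper half-ball of radius `(7/8)r₁/h` at the root pin is in `K`.**
[folklore] -/
theorem mem_K_of_upper_zero {F : HexVertex} {w : ℂ} (hw : w ∈ triCell F) (hwB : ‖w - p0n‖ < 7 / 8 * (r₁ / h))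
    (him : p0n.im < w.im) : F ∈ tileFaces S ∪ R₁ ∪ R₀ := by
  have hrh : 4000 ≤ r₁ / h := by rw [le_div_iff₀ hh]; linarith
  have him' : 0 < (w - p0n).im := by rw [Complex.sub_im]; linarith
  by_cases h9 : 9 ≤ (w - p0n).im
  · have hSc : ∀ c : Site 2, (c 0 - c 1) % 3 = 0 → 5 * h ≤ infDist (o + h * triEmbed c) Ωᶜ → c ∈ S :=
      fun c h1 h2 => (hS c).2 ⟨h1, h2⟩
    refine Finset.mem_union_left _ (Finset.mem_union_left _ (mem_tileFaces_of_deep o hh.le hSc hw ?_))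
    have hd := hdepth0 w (by linarith)
    have h1 : 9 * h ≤ h * (w - p0n).im := by nlinarith
    have h2 : 9 * h ≤ r₁ - h * ‖w - p0n‖ := by
      have : h * ‖w - p0n‖ < h * (7 / 8 * (r₁ / h)) := mul_lt_mul_of_pos_left hwB hh
      have e : h * (7 / 8 * (r₁ / h)) = 7 / 8 * r₁ := by field_simp
      nlinarith
    have := le_min h1 h2
    linarith
  · refine Finset.mem_union_right _ ?_
    exact mem_trapezoid_of_low hR₀ hp0n.1 hp0n.2 (Rb := 7 / 8 * (r₁ / h)) (by linarith [ha₀.2]) hw hwB him'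
      (not_le.1 h9)

include hh hS in
/-- **Every cell meeting a `9h`-deep point is in `K`** (a tile face). [folklore] -/
theorem mem_K_of_deep {F : HexVertex} {w : ℂ} (hw : w ∈ triCell F) (hdeep : 9 * h ≤ infDist (o + h * w) Ωᶜ) :
    F ∈ tileFaces S ∪ R₁ ∪ R₀ := by
  have hSc : ∀ c : Site 2, (c 0 - c 1) % 3 = 0 → 5 * h ≤ infDist (o + h * triEmbed c) Ωᶜ → c ∈ S :=
    fun c h1 h2 => (hS c).2 ⟨h1, h2⟩
  exact Finset.mem_union_left _ (Finset.mem_union_left _ (mem_tileFaces_of_deep o hh.le hSc hw (by linarith)))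

end Pins

/-! ### 7. The deep core and the normalised flat pins of a datum -/

/-- A connected compact subset of `Ω` through the `η`-deep part and two given points of `Ω`, with a
positive depth. [folklore] -/
theorem exists_deep_core (D : DobrushinDomain) {η : ℝ} (hη : 0 < η) {q₁ q₀ : ℂ} (hq₁ : q₁ ∈ D.carrier)
    (hq₀ : q₀ ∈ D.carrier) :
    ∃ (K' : Set ℂ) (d' : ℝ), IsCompact K' ∧ IsConnected K' ∧ K' ⊆ D.carrier ∧ 0 < d' ∧
      (∀ z ∈ K', d' ≤ infDist z D.carrierᶜ) ∧ q₁ ∈ K' ∧ q₀ ∈ K' ∧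
      {z : ℂ | z ∈ D.carrier ∧ η ≤ infDist z D.carrierᶜ} ⊆ K' := by
  set C : Set ℂ := {z : ℂ | η ≤ infDist z D.carrierᶜ} ∪ {q₁, q₀} with hC
  have hCΩ : C ⊆ D.carrier := by
    rintro z (hz | hz)
    · exact mem_of_infDist_pos (lt_of_lt_of_le hη hz)
    · rcases hz with rfl | rfl
      · exact hq₁
      · exact hq₀
  have hCc : IsCompact C := by
    refine IsCompact.union ?_ ((Set.finite_singleton q₀).insert q₁).isCompact
    refine Metric.isCompact_of_isClosed_isBounded (isClosed_le continuous_const (continuous_infDist_pt _)) ?_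
    exact D.isBounded.subset fun z hz => mem_of_infDist_pos (lt_of_lt_of_le hη hz)
  obtain ⟨K', hK'c, hK'conn, hCK', hK'Ω⟩ := Literature.Analysis.FluidPDE.exists_isCompact_isConnected_superset
    D.isOpen D.isConnected hCc hCΩ ⟨q₁, Or.inr (Or.inl rfl)⟩
  obtain ⟨z₀, hz₀, hmin⟩ := hK'c.exists_isMinOn ⟨q₁, hCK' (Or.inr (Or.inl rfl))⟩ (continuous_infDist_pt _).continuousOn
  have hΩc : D.carrierᶜ.Nonempty := Set.nonempty_compl.2 D.carrier_ne_univ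
  have hpos : 0 < infDist z₀ D.carrierᶜ := by
    obtain ⟨ε, hε, hball⟩ := Metric.isOpen_iff.1 D.isOpen z₀ (hK'Ω hz₀)
    exact lt_of_lt_of_le hε (le_infDist_of_ball_subset hΩc hball)
  refine ⟨K', infDist z₀ D.carrierᶜ, hK'c, hK'conn, hK'Ω, hpos, fun z hz => hmin hz, hCK' (Or.inr (Or.inl rfl)),
    hCK' (Or.inr (Or.inr rfl)), fun z hz => hCK' (Or.inl hz.2)⟩

/-- **Normalised flat pins**: the real flat-ball hypothesis at a pin, read in the normalised
coordinate `w ↦ o + h·w` about the normalised pin point `c` (`o + h·c` the pin). [folklore] -/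
theorem flat_normalised {Ω : Set ℂ} {o c x : ℂ} {h R : ℝ} (hh : 0 < h) (hx : o + h * c = x)
    (hflat : Ω ∩ ball x R = {z : ℂ | x.im < z.im} ∩ ball x R) (hΩ : Ωᶜ.Nonempty) (w : ℂ) (hw : ‖w - c‖ < R / h) :
    (o + h * w ∈ Ω ↔ c.im < w.im) ∧ min (h * (w - c).im) (R - h * ‖w - c‖) ≤ infDist (o + h * w) Ωᶜ := by
  have hball : o + h * w ∈ ball x R := by
    rw [← hx, sim_mem_ball_iff o hh, mem_ball, dist_eq_norm]; exact hw
  have hd : dist (o + h * w) x = h * ‖w - c‖ := by rw [← hx, dist_sim o hh.le, dist_eq_norm]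
  have him : (o + ↑h * w).im - x.im = h * (w - c).im := by rw [← hx]; simp; ring
  constructor
  · rw [← sim_im_lt_iff o hh w c, hx]
    constructor
    · intro hin
      have : o + h * w ∈ Ω ∩ ball x R := ⟨hin, hball⟩
      rw [hflat] at this; exact this.1
    · intro hlt
      have : o + h * w ∈ {z : ℂ | x.im < z.im} ∩ ball x R := ⟨hlt, hball⟩
      rw [← hflat] at this; exact this.1
  · have := depth_flat_ball hΩ hflat (o + h * w)
    rwa [hd, him] at this

/-- **Vertical escape** (registered form, sub-goal of `stub_innerZigzagPolygon`): a point of an open `P`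
with `P ⊔ V = (frontier P)ᶜ` cannot see, straight below it off `frontier P`, a point of `V`. [folklore] -/
theorem vertical_escape_abs : ∀ (P V : Set ℂ), IsOpen P → IsOpen V → Disjoint P V → P ∪ V = (frontier P)ᶜ → ∀ (w : ℂ), w ∈ P → ∀ (σ : ℝ), σ ≤ w.im → (∀ s : ℝ, σ ≤ s → s < w.im → (⟨w.re, s⟩ : ℂ) ∉ frontier P) → (⟨w.re, σ⟩ : ℂ) ∈ V → False :=
  fun _ _ hPo hVo hPV hunion _ hw _ hσ hoff hbot => vertical_escape hPo hVo hPV hunion hw hσ hoff hbot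

end Summit.CriticalPhenomena.SAWScalingLimit.Theorems.PolygonParitySqueeze.InnerZigzag

end
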